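import Literature.NumberTheory.Sieve.LargestPrimeFactorCubicGoodCubes
import Literature.NumberTheory.Sieve.LargestPrimeFactorCubicCubeSum
import Literature.NumberTheory.Sieve.LargestPrimeFactorCubicVolumeGeneral
import HarnessLib

/-!
# Heath-Brown 2001 (PLMS), §8: `∑_{good cubes} M³/N_𝓑⁺ ≥ (1 + η/2)⁻¹ · I(shrunk box)`

Topic `Literature/NumberTheory/Sieve`; a PROVED layer (definitions with bodies, no named facts) under the
named fact `Irving2015_largestPrimeFactor_cubic` (`LargestPrimeFactorCubic.lean`), joining `…GoodCubes`
(every `m`-neighbour of a point of the shrunk box `𝓢_η` lies in `𝓡₀ = InBox N₁ N₂ M₃`), `…CubeSum`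
(the abstract covering-to-integral inequality over grid cubes) and `…VolumeGeneral` (`genVolume`, the
value of `∫ dx/N` over a norm–unit–angle box).  Source: D. R. Heath-Brown, *The largest prime factor of
`X³ + 2`*, Proc. London Math. Soc. (3) 82 (2001) 554–596, §8 pp. 30–34: the main term of a good cube is
`C₂X^{−3δ}M³/N_𝓑` ((8.6)–(8.7)), "the sum over cubes `𝓑` is essentially `∫ dx dy dz/N = I₁`" (p. 33),
and `I₂ − I₁ ≪ X^{−δ/6}` ((8.10)–(8.14)).  For the LOWER bound we PROVE:

* `coords_pos_of_window` — in the window `2N^{1/3} < σ₁ < 2E N^{1/3}` all three coordinates are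
  positive (`3ρx₂ = σ₁ − Re v + √3 Im v ≥ σ₁ − 2|v| > (2 − √2)N^{1/3}`), so the grid `k ∈ ℕ³` suffices;
* `GoodIdx`, `goodSet`, `corner`, `Nplus k = N(corner) + ηN₁/4`;
* **`exists_good_cube`** — every `x ∈ 𝓢_η` lies in a good grid cube of index `< K` (`6N₂^{1/3} ≤ Km`);
* **`inv_normForm_le`** — on a good cube `1/N(y) ≤ (1 + η/2)/N⁺_k` and `N(y) ≤ N⁺_k`;
* **`genVolume_shrunk_le`** — `I(𝓢_η) = genVolume (2(1+η)) (2E(1−η)) (−2π/3+η) (π/3−η) (N₁(1+η)) (N₂(1−η))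
  ≤ (1 + η/2) ∑_{k good} m³/N⁺_k`, under the smallness conditions of `inBox_of_supClose`.

## References

* D. R. Heath-Brown, *The largest prime factor of `X³ + 2`*, Proc. London Math. Soc. (3) 82 (2001)
  554–596, §8 pp. 30–34. [`HeathBrown2001LargestPrimeFactorCubic`]

## Mathlib / tree search

Tree: `InBox`, `InShrunk`, `SupClose`, `window_bounds`, `abs_normForm_sub_le_of_supClose`,
`inBox_of_supClose` (`…GoodCubes`); `gridCube`, `gridIdx`, `mem_gridCube_gridIdx`,
`abs_sub_le_of_mem_gridCube`, `gridIdx_mem`, `integral_indicator_le_sum_cubes` (`…CubeSum`);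
`genVolume`, `genIntegrand`, `genRegion` (`…VolumeGeneral`); `cplxEmb_re/im`, `ell`
(`HeathBrownCubicPolar/Window`), `rpow_third_pow_three`.
-/

noncomputable section

open Finset Real MeasureTheory

namespace Literature.NumberTheory.Sieve.HeathBrown2001

open CubicSieve

/-! ### Positivity of the coordinates in the window -/

/-- In the window `2N^{1/3} < σ₁(x) < 2E N^{1/3}` (`N = N(x) > 0`) all coordinates are positive.
[cite: HeathBrown2001LargestPrimeFactorCubic, §8 p. 32 (x = (w + 2r cos θ)/3 etc.)] -/
theorem coords_pos_of_window {x : ℝ × ℝ × ℝ} (hN : 0 < normForm x)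
    (h1 : 2 * (normForm x) ^ ((1 : ℝ) / 3) < ell x) (h2 : ell x < 2 * unitE * (normForm x) ^ ((1 : ℝ) / 3)) :
    0 < x.1 ∧ 0 < x.2.1 ∧ 0 < x.2.2 := by
  have hc0 : 0 < (normForm x) ^ ((1 : ℝ) / 3) := Real.rpow_pos_of_pos hN _
  obtain ⟨-, hQlt, -, hx1⟩ := window_bounds hN h1 h2
  set c := (normForm x) ^ ((1 : ℝ) / 3) with hc
  have hr := rho_pos
  have hs3 : Real.sqrt 3 ^ 2 = 3 := Real.sq_sqrt (by norm_num)
  set a := (cplxEmb x).re with ha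
  set b := (cplxEmb x).im with hb
  have hv2 : a * a + b * b < c ^ 2 / 2 := by
    rw [ha, hb, ← Complex.normSq_apply]; exact hQlt
  -- `3ρx₂ = ell − (Re v − √3 Im v)`, `3ρ²x₃ = ell − (Re v + √3 Im v)`
  have e2 : 3 * (rho * x.2.1) = ell x - (a - Real.sqrt 3 * b) := by
    rw [ha, hb, cplxEmb_re, cplxEmb_im]; simp only [ell]
    linear_combination (-(1 / 2) * (rho * x.2.1 - rho ^ 2 * x.2.2)) * hs3
  have e3 : 3 * (rho ^ 2 * x.2.2) = ell x - (a + Real.sqrt 3 * b) := by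
    rw [ha, hb, cplxEmb_re, cplxEmb_im]; simp only [ell]
    linear_combination ((1 / 2) * (rho * x.2.1 - rho ^ 2 * x.2.2)) * hs3
  -- Cauchy–Schwarz
  have k1 : 4 * (a * a + b * b) - (a - Real.sqrt 3 * b) ^ 2 = (Real.sqrt 3 * a + b) ^ 2 := by
    linear_combination (-(a ^ 2 + b ^ 2)) * hs3
  have k2 : 4 * (a * a + b * b) - (a + Real.sqrt 3 * b) ^ 2 = (Real.sqrt 3 * a - b) ^ 2 := by
    linear_combination (-(a ^ 2 + b ^ 2)) * hs3
  have hsq1 : (a - Real.sqrt 3 * b) ^ 2 < (2 * c) ^ 2 := by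
    nlinarith [sq_nonneg (Real.sqrt 3 * a + b)]
  have hsq2 : (a + Real.sqrt 3 * b) ^ 2 < (2 * c) ^ 2 := by
    nlinarith [sq_nonneg (Real.sqrt 3 * a - b)]
  have hlt1 := abs_lt.mp (abs_lt_of_sq_lt_sq hsq1 (by positivity))
  have hlt2 := abs_lt.mp (abs_lt_of_sq_lt_sq hsq2 (by positivity))
  have hx2 : 0 < 3 * (rho * x.2.1) := by rw [e2]; linarith [hlt1.2]
  have hx3 : 0 < 3 * (rho ^ 2 * x.2.2) := by rw [e3]; linarith [hlt2.2]
  have hr2 : 0 < rho ^ 2 := by positivity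
  refine ⟨by linarith, ?_, ?_⟩
  · by_contra h; push Not at h
    have : rho * x.2.1 ≤ 0 := mul_nonpos_of_nonneg_of_nonpos hr.le h
    linarith
  · by_contra h; push Not at h
    have : rho ^ 2 * x.2.2 ≤ 0 := mul_nonpos_of_nonneg_of_nonpos hr2.le h
    linarith
/-! ### Good grid cubes and the weights `N⁺_k` -/

/-- A grid cube is **good** if it lies inside `𝓡₀ = InBox N₁ N₂ M₃`.
[cite: HeathBrown2001LargestPrimeFactorCubic, §8 p. 30] -/
def GoodIdx (N₁ N₂ M₃ m : ℝ) (k : ℕ × ℕ × ℕ) : Prop := ∀ y ∈ gridCube m k, InBox N₁ N₂ M₃ y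

open scoped Classical in
/-- The good indices in the grid `(range K)³`. [cite: HeathBrown2001LargestPrimeFactorCubic, §8 p. 30] -/
def goodSet (N₁ N₂ M₃ m : ℝ) (K : ℕ) : Finset (ℕ × ℕ × ℕ) :=
  (Finset.range K ×ˢ (Finset.range K ×ˢ Finset.range K)).filter (GoodIdx N₁ N₂ M₃ m)

/-- The lower corner `(k₁m, k₂m, k₃m)` of the grid cube `k`. [folklore] -/
def corner (m : ℝ) (k : ℕ × ℕ × ℕ) : ℝ × ℝ × ℝ := ((k.1 : ℝ) * m, (k.2.1 : ℝ) * m, (k.2.2 : ℝ) * m)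

/-- The corner lies in its cube (`m ≥ 0`). [folklore] -/
theorem corner_mem_gridCube {m : ℝ} (hm : 0 ≤ m) (k : ℕ × ℕ × ℕ) : corner m k ∈ gridCube m k := by
  refine ⟨⟨le_rfl, ?_⟩, ⟨le_rfl, ?_⟩, ⟨le_rfl, ?_⟩⟩ <;> simp only [corner] <;> nlinarith

/-- `N⁺_k = N(corner) + ηN₁/4`, an upper bound for `N` on a good cube. [cite: HeathBrown2001LargestPrimeFactorCubic, §8 (8.4)] -/
def Nplus (η N₁ m : ℝ) (k : ℕ × ℕ × ℕ) : ℝ := normForm (corner m k) + η * N₁ / 4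

/-! ### Every point of the shrunk box lies in a good cube -/

/-- **Covering**: under the smallness conditions of `inBox_of_supClose` and `6N₂^{1/3} ≤ Km`, every
`x ∈ 𝓢_η` lies in `gridCube m k` for a good index `k ∈ goodSet`.
[cite: HeathBrown2001LargestPrimeFactorCubic, §8 pp. 33–34] -/
theorem exists_good_cube {N₁ N₂ M₃ η m : ℝ} {K : ℕ} (hN₁ : 0 < N₁) (hN : N₁ ≤ N₂) (hη : 0 < η)
    (hη1 : η ≤ 1 / 2) (hm : 0 < m)
    (C1 : 1404 * N₂ ^ ((2 : ℝ) / 3) * m ≤ η * N₁ / 4) (C2 : 6000 * m ≤ η * N₁ ^ ((1 : ℝ) / 3))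
    (C3 : M₃ ≤ η * N₁ / 5000) (hK : 6 * N₂ ^ ((1 : ℝ) / 3) ≤ K * m)
    {x : ℝ × ℝ × ℝ} (hx : InShrunk η N₁ N₂ x) :
    ∃ k ∈ goodSet N₁ N₂ M₃ m K, x ∈ gridCube m (k) := by
  classical
  -- `x` itself is in `InBox` (take `y = x`), hence in the window, hence has small positive coordinates
  have hxx : SupClose m x x := by
    refine ⟨?_, ?_, ?_⟩ <;> simp [hm.le]
  obtain ⟨hxN1, hxN2, hw1, hw2, -⟩ := inBox_of_supClose hN₁ hN hη hη1 hm C1 C2 C3 hx hxx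
  have hNx : 0 < normForm x := hN₁.trans hxN1
  obtain ⟨hcoord, -, -, -⟩ := window_bounds hNx hw1 hw2
  obtain ⟨hp1, hp2, hp3⟩ := coords_pos_of_window hNx hw1 hw2
  have hN₂ : 0 < N₂ := hN₁.trans_le hN
  have hcT : (normForm x) ^ ((1 : ℝ) / 3) ≤ N₂ ^ ((1 : ℝ) / 3) :=
    Real.rpow_le_rpow hNx.le hxN2.le (by norm_num)
  have hlt : ∀ t : ℝ, |t| ≤ 5 * (normForm x) ^ ((1 : ℝ) / 3) → t < K * m := by
    intro t ht
    have := (abs_le.mp ht).2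
    have h0 : 0 < N₂ ^ ((1 : ℝ) / 3) := Real.rpow_pos_of_pos hN₂ _
    linarith
  refine ⟨gridIdx m x, ?_, mem_gridCube_gridIdx hm ⟨hp1.le, hp2.le, hp3.le⟩⟩
  rw [goodSet, Finset.mem_filter]
  refine ⟨gridIdx_mem hm ⟨hp1.le, hp2.le, hp3.le⟩ ⟨hlt _ hcoord.1, hlt _ hcoord.2.1, hlt _ hcoord.2.2⟩, ?_⟩
  intro y hy
  have hxy : SupClose m x y := abs_sub_le_of_mem_gridCube (mem_gridCube_gridIdx hm ⟨hp1.le, hp2.le, hp3.le⟩) hy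
  exact inBox_of_supClose hN₁ hN hη hη1 hm C1 C2 C3 hx hxy

/-! ### The weights on a good cube -/

/-- **On a good cube** `k`: `N(y) ≤ N⁺_k` and `1/N(y) ≤ (1 + η/2)/N⁺_k` for all `y` in the cube
(`|N(y) − N(corner)| ≤ 1404 N₂^{2/3} m ≤ ηN₁/4` by (8.4)); also `0 < N⁺_k`.
[cite: HeathBrown2001LargestPrimeFactorCubic, §8 (8.4) and p. 33 ("∫_𝓑 |N⁻¹ − N_𝓑⁻¹| ≪ …")] -/
theorem inv_normForm_le {N₁ N₂ M₃ η m : ℝ} (hN₁ : 0 < N₁) (hN : N₁ ≤ N₂) (hη : 0 < η) (hη1 : η ≤ 1 / 2)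
    (hm : 0 < m)
    (C1 : 1404 * N₂ ^ ((2 : ℝ) / 3) * m ≤ η * N₁ / 4) (C2 : 6000 * m ≤ η * N₁ ^ ((1 : ℝ) / 3))
    {k : ℕ × ℕ × ℕ} (hk : GoodIdx N₁ N₂ M₃ m k) {y : ℝ × ℝ × ℝ} (hy : y ∈ gridCube m k) :
    0 < Nplus η N₁ m k ∧ normForm y ≤ Nplus η N₁ m k ∧
      (normForm y)⁻¹ ≤ (1 + η / 2) / Nplus η N₁ m k := by
  set z := corner m k with hz
  have hzmem : z ∈ gridCube m k := corner_mem_gridCube hm.le k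
  obtain ⟨hzN1, hzN2, hzw1, hzw2, -⟩ := hk z hzmem
  obtain ⟨hyN1, -, -, -, -⟩ := hk y hy
  have hN₂ : 0 < N₂ := hN₁.trans_le hN
  have hNz : 0 < normForm z := hN₁.trans hzN1
  obtain ⟨hcoord, -, -, -⟩ := window_bounds hNz hzw1 hzw2
  -- `m ≤ c_z` and `c_z ≤ N₂^{1/3}`
  have hT2 : N₂ ^ ((2 : ℝ) / 3) = (N₂ ^ ((1 : ℝ) / 3)) ^ 2 := by
    rw [← Real.rpow_natCast, ← Real.rpow_mul hN₂.le]; norm_num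
  rw [hT2] at C1
  have hcz0 : 0 < (normForm z) ^ ((1 : ℝ) / 3) := Real.rpow_pos_of_pos hNz _
  have hczT : (normForm z) ^ ((1 : ℝ) / 3) ≤ N₂ ^ ((1 : ℝ) / 3) :=
    Real.rpow_le_rpow hNz.le hzN2.le (by norm_num)
  have htcz : N₁ ^ ((1 : ℝ) / 3) ≤ (normForm z) ^ ((1 : ℝ) / 3) :=
    Real.rpow_le_rpow hN₁.le hzN1.le (by norm_num)
  have ht0 : 0 < N₁ ^ ((1 : ℝ) / 3) := Real.rpow_pos_of_pos hN₁ _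
  have hmcz : m ≤ (normForm z) ^ ((1 : ℝ) / 3) := by
    have : η * N₁ ^ ((1 : ℝ) / 3) ≤ 1 / 2 * N₁ ^ ((1 : ℝ) / 3) := mul_le_mul_of_nonneg_right hη1 ht0.le
    linarith
  have hΔ := abs_normForm_sub_le_of_supClose hm.le hmcz hcoord (abs_sub_le_of_mem_gridCube hzmem hy)
  have hΔ' : 1404 * ((normForm z) ^ ((1 : ℝ) / 3)) ^ 2 * m ≤ η * N₁ / 4 := by
    have : ((normForm z) ^ ((1 : ℝ) / 3)) ^ 2 ≤ (N₂ ^ ((1 : ℝ) / 3)) ^ 2 := pow_le_pow_left₀ hcz0.le hczT 2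
    have := mul_le_mul_of_nonneg_right this hm.le
    linarith
  obtain ⟨hΔ1, hΔ2⟩ := abs_le.mp hΔ
  have hplus : normForm y ≤ Nplus η N₁ m k := by unfold Nplus; rw [← hz]; linarith
  have hpos : 0 < Nplus η N₁ m k := by unfold Nplus; rw [← hz]; positivity
  refine ⟨hpos, hplus, ?_⟩
  have hNy : 0 < normForm y := hN₁.trans hyN1
  rw [inv_eq_one_div, div_le_div_iff₀ hNy hpos, one_mul]
  unfold Nplus; rw [← hz]
  have hηN : η * N₁ ≤ η * normForm y := mul_le_mul_of_nonneg_left hyN1.le hη.le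
  nlinarith

/-! ### The integral inequality -/

/-- **`I(𝓢_η) ≤ (1 + η/2) ∑_{k good} m³/N⁺_k`**: the volume integral over the shrunk box is at most
`(1 + η/2)` times the cube sum over the good cubes of side `m` in the grid `(range K)³`, under the
smallness conditions of `inBox_of_supClose` and `6N₂^{1/3} ≤ Km`.
[cite: HeathBrown2001LargestPrimeFactorCubic, §8 pp. 30–34 (I₁, (8.3)–(8.7), (8.10)–(8.14))] -/
theorem genVolume_shrunk_le {N₁ N₂ M₃ η m : ℝ} {K : ℕ} (hN₁ : 0 < N₁) (hN : N₁ ≤ N₂) (hη : 0 < η)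
    (hη1 : η ≤ 1 / 2) (hm : 0 < m)
    (C1 : 1404 * N₂ ^ ((2 : ℝ) / 3) * m ≤ η * N₁ / 4) (C2 : 6000 * m ≤ η * N₁ ^ ((1 : ℝ) / 3))
    (C3 : M₃ ≤ η * N₁ / 5000) (hK : 6 * N₂ ^ ((1 : ℝ) / 3) ≤ K * m) :
    genVolume (2 * (1 + η)) (2 * unitE * (1 - η)) (-(2 * Real.pi / 3) + η) (Real.pi / 3 - η)
        (N₁ * (1 + η)) (N₂ * (1 - η)) ≤
      (1 + η / 2) * ∑ k ∈ goodSet N₁ N₂ M₃ m K, m ^ 3 / Nplus η N₁ m k := by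
  classical
  -- the integral is `∫ 𝟙_S F` with `S = {InShrunk}`, `F = 1/N`
  set S : Set (ℝ × ℝ × ℝ) := {x | InShrunk η N₁ N₂ x} with hS
  have hvol : genVolume (2 * (1 + η)) (2 * unitE * (1 - η)) (-(2 * Real.pi / 3) + η) (Real.pi / 3 - η)
      (N₁ * (1 + η)) (N₂ * (1 - η)) = ∫ x, S.indicator (fun x => (normForm x)⁻¹) x := by
    rfl
  rw [hvol]
  have h := integral_indicator_le_sum_cubes (S := S) (F := fun x => (normForm x)⁻¹) hm
    (goodSet N₁ N₂ M₃ m K) (fun k => (1 + η / 2) / Nplus η N₁ m k) ?_ ?_ ?_ ?_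
  · refine h.trans (le_of_eq ?_)
    rw [Finset.mul_sum]
    exact Finset.sum_congr rfl fun k _ => by ring
  · intro k hk
    rw [goodSet, Finset.mem_filter] at hk
    have := (inv_normForm_le hN₁ hN hη hη1 hm C1 C2 hk.2 (corner_mem_gridCube hm.le k)).1
    positivity
  · intro x hx
    exact exists_good_cube hN₁ hN hη hη1 hm C1 C2 C3 hK hx
  · intro k hk y hy
    rw [goodSet, Finset.mem_filter] at hk
    exact (inv_normForm_le hN₁ hN hη hη1 hm C1 C2 hk.2 hy).2.2
  · intro x hx
    obtain ⟨h1, -⟩ := (hx : InShrunk η N₁ N₂ x)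
    have : 0 < normForm x := by
      have : 0 < N₁ * (1 + η) := by positivity
      linarith
    positivity


end Literature.NumberTheory.Sieve.HeathBrown2001
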